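import Mathlib
import Summits.KontsevichZagierPeriods.Zeta5Search.BrickResidueLawCirc

/-!
# BrickLambdaDigit — THEOREM 7 LEMMA 3 (i) and (iv) for the ° cells: EXACT (ANTI)SYMMETRY `λ_{n−j} = −λ_j`,
`λ̃_{M−k} = λ̃_k`, and the BOTTOM DIGIT `λ_j ≡ c_{j₀,A}(n₀) (mod p)` in every carry type (cell zeta5-irr)

HONEST FRAMING: systematic search; no irrationality claim unless certified. INSTRUMENT lemmas of the ζ(5)
census cell zeta5-irr (HOME `run/shared/lean/pub/zeta5-irr/`; memo `zi-p2/probes/B8/thm7/THEOREM7.md` §2 LEMMA 3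
«(i) EXACT (ANTI)SYMMETRY: for K₀ ≤ N₀ (c_h = 0), λ_{N−K} = −λ_K (full kernel) and λ̃_{M−k} = λ̃_k (symmetric kernel)
… (iv) BOTTOM DIGIT: for c_h = 0, λ_K ≡ c_{K₀,A}(N₀) (mod p) … [it is ≡ 0 mod p exactly when c_a = 1 or δ_b = 1 or
c_c = 1, by Kummer resp. the factor (N₀−2K₀)/2]»; `zi-p2/probes/B8/thm8/THEOREM8.md` §2 fact (°)). Nothing here is
about ζ(5); no irrationality content; filing moves no rung. Filed by the engine seat zi-eng (g9); sequel of
`BrickLambda` (zi-eng g8: the main case `lambda_congr`), `BrickResidueLawCirc` (`lambda_circ`: `v(λ_j) ≥ m`) and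
`BrickTopCoefficient.cTop_reflect`.

## The statements

`p` odd prime; `λ_j := cTop A B ε n j / cTop A B 0 N J` for `n = n₀ + Np`, `j = j₀ + Jp`, `j₀ ≤ n₀ < p`, `J ≤ N`.
* `cTop_zero_reflect`: `c̃_{n−j,A}(n) = c̃_{j,A}(n)` (`A` even); with `cTop_reflect` (`ε = 1`, sign `−1`):
  **`lambda_reflect`**: `λ_{n−j} = (−1)^ε·λ_j` (`ε ≤ 1`, `A` even) — the digits of `n − j` are `(n₀−j₀, N−J)`
  (`sub_digit`), so this is LEMMA 3 (i) for every ° cell.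
* `cTop_digit_lt`: the one-digit coefficient `c_{j₀,A}(n₀)` is `≡ 0 (mod p)` as soon as one carry occurs
  (`n₀ + j₀ ≥ p`, or `2n₀ − j₀ ≥ p`, or `ε ≥ 1 ∧ p ∣ n₀ − 2j₀`; `B ≥ 1`).
* **`lambda_congr_circ`**: `v(λ_j − c_{j₀,A}(n₀)) < 1` for EVERY ° cell (`1 ≤ B`, every `ε`, the exact centre
  included) — LEMMA 3 (iv): the main case is `BrickLambda.lambda_congr`, in the carry cases both
  sides vanish mod `p` (`lambda_circ` gives `v(λ_j) ≥ m ≥ 1`).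
-/

namespace Summit.KontsevichZagierPeriods.Zeta5Search.BrickLambdaDigit

open Finset Nat WithZero
open Summit.KontsevichZagierPeriods.Zeta5Search.BrickTopCoefficient (cTop cTop_reflect)
open Summit.KontsevichZagierPeriods.Zeta5Search.BrickLambda (cTop_zero_ne_zero padicValuation_two)
open Summit.KontsevichZagierPeriods.Zeta5Search.BrickTopKummer (one_le_padicValNat_choose_add
  padicValuation_natCast_le_exp_neg)
open Summit.KontsevichZagierPeriods.Zeta5Search.BrickResidueLawMain (lambda_main)
open Summit.KontsevichZagierPeriods.Zeta5Search.BrickDigitStripCirc (centreCarry)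
open Summit.KontsevichZagierPeriods.Zeta5Search.BrickDigitStripCarry (div_two_carry_le_one)
open Summit.KontsevichZagierPeriods.Zeta5Search.BrickLambdaCirc (padicValuation_cTop_eq padicValuation_centre_eq_one)
open Summit.KontsevichZagierPeriods.Zeta5Search.BrickResidueLawCirc (lambda_circ)
open Literature.NumberTheory.LFunctions (padicValuation_natCast_le_one)

noncomputable section

variable {p : ℕ} [Fact p.Prime]

/-! ## LEMMA 3 (i): exact (anti)symmetry -/

/-- Reflection INVARIANCE of the symmetric top coefficient: `c̃_{n−j,A}(n) = c̃_{j,A}(n)` for even `A`, `j ≤ n`. -/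
theorem cTop_zero_reflect {A : ℕ} (hA : Even A) (B : ℕ) {n j : ℕ} (hj : j ≤ n) :
    cTop A B 0 n (n - j) = cTop A B 0 n j := by
  unfold cTop
  have h1 : n.choose (n - j) = n.choose j := Nat.choose_symm hj
  have h2 : (n + (n - j)).choose (n - j) = (2 * n - j).choose n := by
    rw [show n + (n - j) = 2 * n - j by omega, ← Nat.choose_symm (show n - j ≤ 2 * n - j by omega)]
    congr 1; omega
  have h3 : (2 * n - (n - j)).choose n = (n + j).choose j := by
    rw [show 2 * n - (n - j) = n + j by omega, ← Nat.choose_symm (show j ≤ n + j by omega)]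
    congr 1; omega
  rw [h1, h2, h3, pow_zero, pow_zero, pow_add, pow_add, (hA.mul_left j).neg_one_pow, (hA.mul_left (n - j)).neg_one_pow]
  ring

/-- Reflection for `ε ≤ 1`: `cTop A B ε n (n−j) = (−1)^ε·cTop A B ε n j` (even `A`). -/
theorem cTop_reflect_le_one {A : ℕ} (hA : Even A) (B : ℕ) {ε : ℕ} (hε : ε ≤ 1) {n j : ℕ} (hj : j ≤ n) :
    cTop A B ε n (n - j) = (-1) ^ ε * cTop A B ε n j := by
  interval_cases ε
  · rw [cTop_zero_reflect hA B hj, pow_zero, one_mul]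
  · rw [cTop_reflect hA B hj, pow_one, neg_one_mul]

omit [Fact p.Prime] in
/-- The digits of `n − j` for a ° cell: `(n₀ + Np) − (j₀ + Jp) = (n₀ − j₀) + (N − J)p`. -/
theorem sub_digit {N n₀ J j₀ : ℕ} (hj₀ : j₀ ≤ n₀) (hJN : J ≤ N) :
    n₀ + N * p - (j₀ + J * p) = (n₀ - j₀) + (N - J) * p := by
  zify [hj₀, hJN, show j₀ + J * p ≤ n₀ + N * p by nlinarith]
  ring

omit [Fact p.Prime] in
/-- **LEMMA 3 (i)**: `λ_{n−j} = (−1)^ε·λ_j` for every ° cell (`A` even, `ε ≤ 1`): the reflected cell `n − j` has digits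
`(n₀ − j₀, N − J)` and `c̃_{N−J,A}(N) = c̃_{J,A}(N)`. -/
theorem lambda_reflect {A : ℕ} (hA : Even A) (B : ℕ) {ε : ℕ} (hε : ε ≤ 1) {N n₀ J j₀ : ℕ} (hj₀ : j₀ ≤ n₀)
    (hJN : J ≤ N) :
    cTop A B ε (n₀ + N * p) (n₀ + N * p - (j₀ + J * p)) / cTop A B 0 N (N - J) =
      (-1) ^ ε * (cTop A B ε (n₀ + N * p) (j₀ + J * p) / cTop A B 0 N J) := by
  rw [cTop_reflect_le_one hA B hε (by nlinarith), cTop_zero_reflect hA B hJN, mul_div_assoc]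

/-! ## LEMMA 3 (iv): the bottom digit -/

/-- The one-digit coefficient vanishes mod `p` as soon as one carry occurs: `n₀ + j₀ ≥ p` (Kummer in `C(n₀+j₀,j₀)`),
`2n₀ − j₀ ≥ p` (Kummer in `C(2n₀−j₀,n₀)`), or `ε ≥ 1` and `p ∣ n₀ − 2j₀` (the centre factor); `B ≥ 1`, odd `p`. -/
theorem cTop_digit_lt (hp2 : p ≠ 2) {A B : ℕ} (hB : 1 ≤ B) {ε n₀ j₀ : ℕ} (hn₀ : n₀ < p) (hj₀ : j₀ ≤ n₀)
    (hcase : p ≤ n₀ + j₀ ∨ p ≤ n₀ + (n₀ - j₀) ∨ (1 ≤ ε ∧ (p : ℤ) ∣ (n₀ : ℤ) - 2 * j₀)) :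
    Rat.padicValuation p (cTop A B ε n₀ j₀) < 1 := by
  have hp : p.Prime := Fact.out
  have hC : ∀ c : ℕ, Rat.padicValuation p (c : ℚ) ≤ 1 := fun c => padicValuation_natCast_le_one c
  have hcen : Rat.padicValuation p ((n₀ : ℚ) / 2 - j₀) ≤ 1 := by
    rw [show (n₀ : ℚ) / 2 - j₀ = (((n₀ : ℤ) - 2 * j₀ : ℤ) : ℚ) / 2 by push_cast; ring, map_div₀,
      padicValuation_two hp2, div_one, Rat.padicValuation_cast]
    exact Int.padicValuation_le_one _ _
  have hlt : exp (-((1 : ℕ) : ℤ)) < (1 : WithZero (Multiplicative ℤ)) := by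
    rw [← exp_zero, exp_lt_exp]; simp
  rw [padicValuation_cTop_eq]
  rcases hcase with h | h | ⟨hε, h⟩
  · have hY := padicValuation_natCast_le_exp_neg (p := p) (Nat.choose_pos (Nat.le_add_left j₀ n₀)).ne'
      (one_le_padicValNat_choose_add (L := 0) (by simpa using hn₀) (by simp; omega) (by simpa using h))
    calc _ ≤ 1 ^ ε * 1 ^ A * (exp (-((1 : ℕ) : ℤ)) * 1) ^ B :=
          mul_le_mul' (mul_le_mul' (pow_le_pow_left' hcen ε) (pow_le_pow_left' (hC _) A))
            (pow_le_pow_left' (mul_le_mul' hY (hC _)) B)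
      _ < 1 := by
          rw [one_pow, one_pow, one_mul, one_mul, mul_one]
          exact pow_lt_one' hlt (by omega)
  · have hZ := padicValuation_natCast_le_exp_neg (p := p) (Nat.choose_pos (Nat.le_add_left n₀ (n₀ - j₀))).ne'
      (one_le_padicValNat_choose_add (L := 0) (n := n₀ - j₀) (k := n₀) (by simp; omega) (by simpa using hn₀)
        (by simp; omega))
    rw [show n₀ - j₀ + n₀ = 2 * n₀ - j₀ by omega] at hZ
    calc _ ≤ 1 ^ ε * 1 ^ A * (1 * exp (-((1 : ℕ) : ℤ))) ^ B :=
          mul_le_mul' (mul_le_mul' (pow_le_pow_left' hcen ε) (pow_le_pow_left' (hC _) A))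
            (pow_le_pow_left' (mul_le_mul' (hC _) hZ) B)
      _ < 1 := by
          rw [one_pow, one_pow, one_mul, one_mul, one_mul]
          exact pow_lt_one' hlt (by omega)
  · have hc : Rat.padicValuation p ((n₀ : ℚ) / 2 - j₀) < 1 := by
      rw [show (n₀ : ℚ) / 2 - j₀ = (((n₀ : ℤ) - 2 * j₀ : ℤ) : ℚ) / 2 by push_cast; ring, map_div₀,
        padicValuation_two hp2, div_one, Rat.padicValuation_cast, Int.padicValuation_lt_one_iff]
      exact h
    calc _ ≤ Rat.padicValuation p ((n₀ : ℚ) / 2 - j₀) ^ ε * 1 ^ A * (1 * 1) ^ B :=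
          mul_le_mul' (mul_le_mul' le_rfl (pow_le_pow_left' (hC _) A))
            (pow_le_pow_left' (mul_le_mul' (hC _) (hC _)) B)
      _ < 1 := by
          rw [one_pow, one_mul, one_pow, mul_one, mul_one]
          exact pow_lt_one' hc (by omega)

/-- **LEMMA 3 (iv) for EVERY ° cell**: `λ_j ≡ c_{j₀,A}(n₀) (mod p)`, i.e. `v(λ_j − cTop A B ε n₀ j₀) < 1`, for
`n = n₀ + Np`, `j = j₀ + Jp`, `j₀ ≤ n₀ < p`, `J ≤ N`, `1 ≤ B`, odd `p` (every `ε`; at the exact centre `2j = n`, `ε ≥ 1`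
both sides vanish too). In the main case this is `BrickLambda.lambda_congr`; in every carry case both sides are `≡ 0`. -/
theorem lambda_congr_circ (hp2 : p ≠ 2) {A B ε N n₀ J j₀ n j : ℕ} (hB : 1 ≤ B)
    (hn : n = n₀ + N * p) (hj : j = j₀ + J * p) (hn₀ : n₀ < p) (hj₀ : j₀ ≤ n₀) (hJN : J ≤ N) :
    Rat.padicValuation p (cTop A B ε n j / cTop A B 0 N J - cTop A B ε n₀ j₀) < 1 := by
  have hp : p.Prime := Fact.out
  by_cases hmain : n₀ + j₀ < p ∧ n₀ + (n₀ - j₀) < p ∧ (ε = 0 ∨ ¬ (p : ℤ) ∣ (n : ℤ) - 2 * j)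
  · exact (lambda_main hp2 (A := A) (B := B) hn hj hj₀ hmain.1 hmain.2.1 hJN).2
  -- a carry occurs: both sides are `≡ 0 (mod p)`
  have hdec : ((n : ℤ) - 2 * j) = ((n₀ : ℤ) - 2 * j₀) + (p : ℤ) * ((N : ℤ) - 2 * J) := by
    rw [hn, hj]; push_cast; ring
  have hm : 1 ≤ B * ((n₀ + j₀) / p) + B * ((n₀ + (n₀ - j₀)) / p) + ε * centreCarry p n j := by
    by_cases h1 : n₀ + j₀ < p
    · by_cases h2 : n₀ + (n₀ - j₀) < p
      · have h3 : ¬ (ε = 0 ∨ ¬ (p : ℤ) ∣ (n : ℤ) - 2 * j) := fun h => hmain ⟨h1, h2, h⟩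
        simp only [not_or, not_not] at h3
        rw [centreCarry, if_pos h3.2]
        have : 1 ≤ ε := Nat.one_le_iff_ne_zero.2 h3.1
        omega
      · have : 1 ≤ (n₀ + (n₀ - j₀)) / p := (Nat.one_le_div_iff hp.pos).2 (by omega)
        have := Nat.mul_le_mul hB this
        omega
    · have : 1 ≤ (n₀ + j₀) / p := (Nat.one_le_div_iff hp.pos).2 (by omega)
      have := Nat.mul_le_mul hB this
      omega
  have hcase : p ≤ n₀ + j₀ ∨ p ≤ n₀ + (n₀ - j₀) ∨ (1 ≤ ε ∧ (p : ℤ) ∣ (n₀ : ℤ) - 2 * j₀) := by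
    by_cases h1 : n₀ + j₀ < p
    · by_cases h2 : n₀ + (n₀ - j₀) < p
      · have h3 : ¬ (ε = 0 ∨ ¬ (p : ℤ) ∣ (n : ℤ) - 2 * j) := fun h => hmain ⟨h1, h2, h⟩
        simp only [not_or, not_not] at h3
        refine Or.inr (Or.inr ⟨Nat.one_le_iff_ne_zero.2 h3.1, ?_⟩)
        have := h3.2
        rw [hdec] at this
        exact (dvd_add_left (dvd_mul_right _ _)).1 this
      · exact Or.inr (Or.inl (by omega))
    · exact Or.inl (by omega)
  have hlam := lambda_circ hp2 (A := A) (B := B) (ε := ε) hn hj hn₀ hj₀ hJN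
    (div_mul_cancel₀ (cTop A B ε n j) (cTop_zero_ne_zero hJN A B))
  have hlam1 : Rat.padicValuation p (cTop A B ε n j / cTop A B 0 N J) < 1 :=
    lt_of_le_of_lt hlam (by rw [← exp_zero, exp_lt_exp]; omega)
  rw [sub_eq_add_neg]
  refine lt_of_le_of_lt (Valuation.map_add _ _ _) (max_lt hlam1 ?_)
  rw [Valuation.map_neg]
  exact cTop_digit_lt hp2 hB hn₀ hj₀ hcase

end

end Summit.KontsevichZagierPeriods.Zeta5Search.BrickLambdaDigit
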